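import Mathlib.NumberTheory.ArithmeticFunction.Zeta
import Mathlib.NumberTheory.DirichletCharacter.Basic
import Mathlib.Data.Nat.Factorization.Basic
import Mathlib.Tactic.LinearCombination
import HarnessLib

/-!
# The twisted divisor sums `σ_j^χ(n) = ∑_{d ∣ n} χ(d) d^j` are Hecke eigen-coefficients

Topic `Literature/NumberTheory/ModularForms`; namespace `Literature.NumberTheory.ModularForms`.
THEOREMS ONLY (no definition, no named fact).

For a Dirichlet character `χ` (any commutative ring `R`, any modulus) and `j ≥ 0`, the
coefficients `a_n = σ_j^χ(n) = ∑_{d ∣ n} χ(d) d^j` (`n ≥ 1`) of the Eisenstein series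
`E_{j+1}^{𝟙,χ}` satisfy, for every prime `q` and `n ≥ 1`, the **Hecke relation**

  `a_{qn} + χ(q) q^j [q ∣ n] a_{n/q} = (1 + χ(q) q^j) a_n`

(`twistedSigma_hecke`): `σ_j^χ` is multiplicative (`twistedSigma_mul_of_coprime`; it is the
Dirichlet convolution of the completely multiplicative `n ↦ χ(n) n^j` with `𝟙` — Mathlib
`ArithmeticFunction.IsMultiplicative.mul`, `isMultiplicative_zeta`) with
`σ_j^χ(q^a) = ∑_{i ≤ a} (χ(q) q^j)^i` (`twistedSigma_prime_pow`).  This is the `q`-expansion form of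
"`E_k^{χ₁,χ₂}` is a normalised eigenform for the full Hecke algebra with
`a_p(E) = χ₁(p) + χ₂(p) p^{k-1}`" (Billerey–Menares §3.1; Miyake Thm. 4.7.1; Diamond–Shurman
Prop. 5.2.3 with Thm. 4.5.2) for `χ₁ = 𝟙`, `χ₂ = χ`, `k = j + 1` — by Diamond–Shurman (5.3),
`a_n(T_q f) = a_{qn}(f) + χ(q) q^{k-1} a_{n/q}(f)` for `f` of nebentypus `χ`.  The same relation
holds for the level-raised coefficients `b_n = a_n - [M ∣ n] a_{n/M}` of
`F₂ = E - E(M·)` at every prime `q ∤ M` (`levelRaised_hecke`; Billerey–Menares §3.2: "`F₂` is an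
eigenform for the full Hecke algebra at level `NM` … for all primes `p ≠ M`").

## References

* N. Billerey, R. Menares, *Strong modularity of reducible Galois representations*, Trans. AMS
  370 (2018), §3.1–3.2. [BillereyMenares2018]
* F. Diamond, J. Shurman, *A First Course in Modular Forms*, GTM 228 (2005), (5.3),
  Prop. 5.2.3, Thm. 4.5.2. [DiamondShurman2005]
* T. Miyake, *Modular Forms*, Springer (1989), Thm. 4.7.1. [Miyake1989]
-/

noncomputable section

open ArithmeticFunction Nat Finset

namespace Literature.NumberTheory.ModularForms

variable {R : Type*} [CommRing R] {N : ℕ} (χ : DirichletCharacter R N) (j : ℕ)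

/-- **`σ_j^χ` is multiplicative**: `σ_j^χ(mn) = σ_j^χ(m) σ_j^χ(n)` for coprime `m, n` — it is the
Dirichlet convolution of the completely multiplicative `n ↦ χ(n) n^j` with `𝟙` (Mathlib
`ArithmeticFunction.IsMultiplicative.mul`, `isMultiplicative_zeta`). [cite: DiamondShurman2005, Prop. 5.2.3 with (4.34); Miyake1989, Thm. 4.7.1] -/
theorem twistedSigma_mul_of_coprime {m n : ℕ} (h : m.Coprime n) :
    ∑ d ∈ (m * n).divisors, χ d * (d : R) ^ j =
      (∑ d ∈ m.divisors, χ d * (d : R) ^ j) * (∑ d ∈ n.divisors, χ d * (d : R) ^ j) := by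
  classical
  let f : ArithmeticFunction R := ⟨fun n ↦ if n = 0 then 0 else χ n * (n : R) ^ j, by simp⟩
  have hfval : ∀ x : ℕ, f x = if x = 0 then 0 else χ x * (x : R) ^ j := fun x ↦ rfl
  have hf : f.IsMultiplicative := by
    refine ⟨by rw [hfval]; simp, fun {a b} _ ↦ ?_⟩
    rw [hfval, hfval, hfval]
    by_cases ha : a = 0
    · simp [ha]
    by_cases hb : b = 0
    · simp [hb]
    simp only [Nat.mul_eq_zero, ha, hb, or_self, ↓reduceIte, Nat.cast_mul, map_mul]
    ring
  let g : ArithmeticFunction R := f * (ArithmeticFunction.zeta : ArithmeticFunction R)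
  have hg : g.IsMultiplicative := hf.mul ArithmeticFunction.isMultiplicative_zeta.natCast
  have hgval : ∀ x : ℕ, g x = ∑ d ∈ x.divisors, χ d * (d : R) ^ j := fun x ↦ by
    show (f * (ArithmeticFunction.zeta : ArithmeticFunction R)) x = _
    rw [ArithmeticFunction.coe_mul_zeta_apply]
    refine Finset.sum_congr rfl fun d hd ↦ ?_
    have hd0 : d ≠ 0 := (Nat.pos_of_mem_divisors hd).ne'
    rw [hfval, if_neg hd0]
  rw [← hgval, ← hgval, ← hgval]
  exact hg.map_mul_of_coprime h

/-- **`σ_j^χ(q^a) = ∑_{i=0}^{a} (χ(q) q^j)^i`** for a prime `q`. [folklore] -/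
theorem twistedSigma_prime_pow {q : ℕ} (hq : q.Prime) (a : ℕ) :
    ∑ d ∈ (q ^ a).divisors, χ d * (d : R) ^ j = ∑ i ∈ range (a + 1), (χ q * (q : R) ^ j) ^ i := by
  rw [Nat.divisors_prime_pow hq a, Finset.sum_map]
  refine Finset.sum_congr rfl fun i _ ↦ ?_
  simp only [Function.Embedding.coeFn_mk, Nat.cast_pow, map_pow]
  ring

/-- The geometric-sum identity behind the Hecke relation at a prime:
`S(a+1) + x [1 ≤ a] S(a-1) = (1 + x) S(a)`, `S(b) = ∑_{i ≤ b} x^i`. [folklore] -/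
theorem geom_sum_hecke (x : R) (a : ℕ) :
    (∑ i ∈ range (a + 2), x ^ i) + x * (if 1 ≤ a then ∑ i ∈ range a, x ^ i else 0) =
      (1 + x) * ∑ i ∈ range (a + 1), x ^ i := by
  cases a with
  | zero =>
    rw [if_neg (by omega)]
    simp only [Finset.sum_range_succ, Finset.sum_range_zero]
    ring
  | succ b =>
    rw [if_pos (by omega), show b + 1 + 2 = (b + 1 + 1) + 1 by ring, geom_sum_succ, geom_sum_succ]
    ring

/-- **The Hecke relation for `σ_j^χ` at a prime `q`**: for `n ≥ 1`,
`σ_j^χ(qn) + χ(q) q^j [q ∣ n] σ_j^χ(n/q) = (1 + χ(q) q^j) σ_j^χ(n)` — i.e. `T_q E = (1 + χ(q)q^j) E`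
for the Eisenstein series `E = E_{j+1}^{𝟙,χ}` with `a_n(E) = σ_j^χ(n)`, via
`a_n(T_q f) = a_{qn}(f) + χ(q) q^{k-1} a_{n/q}(f)` (Diamond–Shurman (5.3)).
[cite: BillereyMenares2018, §3.1 (`a_p(E) = χ₁(p) + χ₂(p)p^{k-1}`); DiamondShurman2005, Prop. 5.2.3] -/
theorem twistedSigma_hecke {q : ℕ} (hq : q.Prime) {n : ℕ} (hn : n ≠ 0) :
    (∑ d ∈ (q * n).divisors, χ d * (d : R) ^ j) +
        χ q * (q : R) ^ j * (if q ∣ n then ∑ d ∈ (n / q).divisors, χ d * (d : R) ^ j else 0) =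
      (1 + χ q * (q : R) ^ j) * ∑ d ∈ n.divisors, χ d * (d : R) ^ j := by
  -- `n = q^a m` with `q ∤ m`
  obtain ⟨a, m, hm, rfl⟩ := Nat.exists_eq_pow_mul_and_not_dvd hn q hq.ne_one
  have hcop : ∀ b, (q ^ b).Coprime m := fun b ↦
    (Nat.Coprime.pow_left b ((Nat.Prime.coprime_iff_not_dvd hq).2 hm))
  have h1 : q * (q ^ a * m) = q ^ (a + 1) * m := by ring
  have hdvd : q ∣ q ^ a * m ↔ 1 ≤ a := by
    constructor
    · intro h
      by_contra ha
      have : a = 0 := by omega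
      subst this
      rw [pow_zero, one_mul] at h
      exact hm h
    · intro ha
      exact (dvd_pow_self q (by omega)).mul_right m
  have hdiv : 1 ≤ a → q ^ a * m / q = q ^ (a - 1) * m := fun ha ↦ by
    obtain ⟨b, rfl⟩ : ∃ b, a = b + 1 := ⟨a - 1, by omega⟩
    rw [Nat.add_sub_cancel, pow_succ, mul_assoc, mul_comm q m, ← mul_assoc, Nat.mul_div_cancel _ hq.pos]
  rw [h1, twistedSigma_mul_of_coprime χ j (hcop (a + 1)), twistedSigma_mul_of_coprime χ j (hcop a),
    twistedSigma_prime_pow χ j hq, twistedSigma_prime_pow χ j hq]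
  have hif : (if q ∣ q ^ a * m then ∑ d ∈ (q ^ a * m / q).divisors, χ d * (d : R) ^ j else 0) =
      (if 1 ≤ a then ∑ i ∈ range a, (χ q * (q : R) ^ j) ^ i else 0) *
        ∑ d ∈ m.divisors, χ d * (d : R) ^ j := by
    by_cases ha : 1 ≤ a
    · rw [if_pos (hdvd.2 ha), if_pos ha, hdiv ha, twistedSigma_mul_of_coprime χ j (hcop (a - 1)),
        twistedSigma_prime_pow χ j hq, Nat.sub_add_cancel ha]
    · rw [if_neg (fun h ↦ ha (hdvd.1 h)), if_neg ha, zero_mul]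
  rw [hif]
  have key := geom_sum_hecke (χ q * (q : R) ^ j) a
  rw [show a + 1 + 1 = a + 2 by ring]
  linear_combination (∑ d ∈ m.divisors, χ d * (d : R) ^ j) * key

/-- **The Hecke relation survives level raising**: for a prime `q ∤ M` (`M ≥ 1`) the coefficients
`b_n = a_n - [M ∣ n] a_{n/M}` of `F₂ = E - E(M·)` (`a_n = σ_j^χ(n)`) satisfy the same relation
`b_{qn} + χ(q) q^j [q ∣ n] b_{n/q} = (1 + χ(q) q^j) b_n`, `n ≥ 1`.
[cite: BillereyMenares2018, §3.2 (`F₂` is an eigenform for the full Hecke algebra at level `NM`, `p ≠ M`)] -/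
theorem levelRaised_hecke {q M : ℕ} (hq : q.Prime) (hqM : ¬ q ∣ M) (hM : M ≠ 0) {n : ℕ}
    (hn : n ≠ 0) :
    ((∑ d ∈ (q * n).divisors, χ d * (d : R) ^ j) -
        (if M ∣ q * n then ∑ d ∈ (q * n / M).divisors, χ d * (d : R) ^ j else 0)) +
      χ q * (q : R) ^ j * (if q ∣ n then
        ((∑ d ∈ (n / q).divisors, χ d * (d : R) ^ j) -
          (if M ∣ n / q then ∑ d ∈ (n / q / M).divisors, χ d * (d : R) ^ j else 0)) else 0) =
      (1 + χ q * (q : R) ^ j) *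
        ((∑ d ∈ n.divisors, χ d * (d : R) ^ j) -
          (if M ∣ n then ∑ d ∈ (n / M).divisors, χ d * (d : R) ^ j else 0)) := by
  have hqM' : Nat.Coprime q M := (Nat.Prime.coprime_iff_not_dvd hq).2 hqM
  have hA := twistedSigma_hecke χ j hq hn
  by_cases hMn : M ∣ n
  · obtain ⟨n', rfl⟩ := hMn
    have hn' : n' ≠ 0 := fun h ↦ hn (by rw [h, mul_zero])
    have hB := twistedSigma_hecke χ j hq hn'
    have e1 : M ∣ q * (M * n') := ⟨q * n', by ring⟩
    have e2 : q * (M * n') / M = q * n' := by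
      rw [show q * (M * n') = M * (q * n') by ring, Nat.mul_div_cancel_left _ (Nat.pos_of_ne_zero hM)]
    have e3 : M * n' / M = n' := Nat.mul_div_cancel_left _ (Nat.pos_of_ne_zero hM)
    have hqiff : q ∣ M * n' ↔ q ∣ n' := ⟨fun h ↦ (hqM'.dvd_of_dvd_mul_left h), fun h ↦ h.mul_left M⟩
    rw [if_pos e1, e2, if_pos (show M ∣ M * n' from ⟨n', rfl⟩), e3]
    by_cases hqn : q ∣ n'
    · obtain ⟨n'', rfl⟩ := hqn
      have e4 : M * (q * n'') / q = M * n'' := by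
        rw [show M * (q * n'') = q * (M * n'') by ring, Nat.mul_div_cancel_left _ hq.pos]
      have e5 : q * n'' / q = n'' := Nat.mul_div_cancel_left _ hq.pos
      have e6 : M * n'' / M = n'' := Nat.mul_div_cancel_left _ (Nat.pos_of_ne_zero hM)
      have hq1 : q ∣ M * (q * n'') := hqiff.2 ⟨n'', rfl⟩
      have hq2 : q ∣ q * n'' := ⟨n'', rfl⟩
      have hM2 : M ∣ M * n'' := ⟨n'', rfl⟩
      rw [if_pos hq1, e4, if_pos hM2, e6]
      rw [if_pos hq1, e4] at hA
      rw [if_pos hq2, e5] at hB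
      linear_combination hA - hB
    · have hqn2 : ¬ q ∣ M * n' := fun h ↦ hqn (hqiff.1 h)
      rw [if_neg hqn2]
      rw [if_neg hqn2] at hA
      rw [if_neg hqn] at hB
      linear_combination hA - hB
  · have e1 : ¬ M ∣ q * n := fun h ↦ hMn (hqM'.symm.dvd_of_dvd_mul_left h)
    rw [if_neg e1, if_neg hMn]
    by_cases hqn : q ∣ n
    · obtain ⟨n'', rfl⟩ := hqn
      have e5 : q * n'' / q = n'' := Nat.mul_div_cancel_left _ hq.pos
      have e7 : ¬ M ∣ n'' := fun h ↦ hMn (h.mul_left q)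
      have hq2 : q ∣ q * n'' := ⟨n'', rfl⟩
      rw [if_pos hq2, e5, if_neg e7]
      rw [if_pos hq2, e5] at hA
      linear_combination hA
    · rw [if_neg hqn]
      rw [if_neg hqn] at hA
      linear_combination hA

/-- **The Hecke relation survives level raising with any weight factor**: for a prime `q ∤ M`
(`M ≥ 1`) and any constant `C` (e.g. `C = M^{k-1} χ'(M)`), the coefficients
`b_n = a_n - C [M ∣ n] a_{n/M}` of `E - C·E(M·)` (`a_n = σ_j^χ(n)`) satisfy
`b_{qn} + χ(q) q^j [q ∣ n] b_{n/q} = (1 + χ(q) q^j) b_n`, `n ≥ 1` — e.g. `E₂(z) - M E₂(Mz)` on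
`Γ₀(M)` (`χ = 𝟙`, `j = 1`, `C = M`; Mazur's Eisenstein series).
[cite: BillereyMenares2018, §3.2; DiamondShurman2005, Prop. 5.2.3] -/
theorem levelRaised_hecke_const (C : R) {q M : ℕ} (hq : q.Prime) (hqM : ¬ q ∣ M) (hM : M ≠ 0)
    {n : ℕ} (hn : n ≠ 0) :
    ((∑ d ∈ (q * n).divisors, χ d * (d : R) ^ j) -
        C * (if M ∣ q * n then ∑ d ∈ (q * n / M).divisors, χ d * (d : R) ^ j else 0)) +
      χ q * (q : R) ^ j * (if q ∣ n then
        ((∑ d ∈ (n / q).divisors, χ d * (d : R) ^ j) -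
          C * (if M ∣ n / q then ∑ d ∈ (n / q / M).divisors, χ d * (d : R) ^ j else 0)) else 0) =
      (1 + χ q * (q : R) ^ j) *
        ((∑ d ∈ n.divisors, χ d * (d : R) ^ j) -
          C * (if M ∣ n then ∑ d ∈ (n / M).divisors, χ d * (d : R) ^ j else 0)) := by
  have hqM' : Nat.Coprime q M := (Nat.Prime.coprime_iff_not_dvd hq).2 hqM
  have hA := twistedSigma_hecke χ j hq hn
  by_cases hMn : M ∣ n
  · obtain ⟨n', rfl⟩ := hMn
    have hn' : n' ≠ 0 := fun h ↦ hn (by rw [h, mul_zero])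
    have hB := twistedSigma_hecke χ j hq hn'
    have e1 : M ∣ q * (M * n') := ⟨q * n', by ring⟩
    have e2 : q * (M * n') / M = q * n' := by
      rw [show q * (M * n') = M * (q * n') by ring, Nat.mul_div_cancel_left _ (Nat.pos_of_ne_zero hM)]
    have e3 : M * n' / M = n' := Nat.mul_div_cancel_left _ (Nat.pos_of_ne_zero hM)
    have hqiff : q ∣ M * n' ↔ q ∣ n' := ⟨fun h ↦ (hqM'.dvd_of_dvd_mul_left h), fun h ↦ h.mul_left M⟩
    rw [if_pos e1, e2, if_pos (show M ∣ M * n' from ⟨n', rfl⟩), e3]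
    by_cases hqn : q ∣ n'
    · obtain ⟨n'', rfl⟩ := hqn
      have e4 : M * (q * n'') / q = M * n'' := by
        rw [show M * (q * n'') = q * (M * n'') by ring, Nat.mul_div_cancel_left _ hq.pos]
      have e5 : q * n'' / q = n'' := Nat.mul_div_cancel_left _ hq.pos
      have e6 : M * n'' / M = n'' := Nat.mul_div_cancel_left _ (Nat.pos_of_ne_zero hM)
      have hq1 : q ∣ M * (q * n'') := hqiff.2 ⟨n'', rfl⟩
      have hq2 : q ∣ q * n'' := ⟨n'', rfl⟩
      have hM2 : M ∣ M * n'' := ⟨n'', rfl⟩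
      rw [if_pos hq1, e4, if_pos hM2, e6]
      rw [if_pos hq1, e4] at hA
      rw [if_pos hq2, e5] at hB
      linear_combination hA - C * hB
    · have hqn2 : ¬ q ∣ M * n' := fun h ↦ hqn (hqiff.1 h)
      rw [if_neg hqn2]
      rw [if_neg hqn2] at hA
      rw [if_neg hqn] at hB
      linear_combination hA - C * hB
  · have e1 : ¬ M ∣ q * n := fun h ↦ hMn (hqM'.symm.dvd_of_dvd_mul_left h)
    rw [if_neg e1, if_neg hMn]
    by_cases hqn : q ∣ n
    · obtain ⟨n'', rfl⟩ := hqn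
      have e5 : q * n'' / q = n'' := Nat.mul_div_cancel_left _ hq.pos
      have e7 : ¬ M ∣ n'' := fun h ↦ hMn (h.mul_left q)
      have hq2 : q ∣ q * n'' := ⟨n'', rfl⟩
      rw [if_pos hq2, e5, if_neg e7]
      rw [if_pos hq2, e5] at hA
      linear_combination hA
    · rw [if_neg hqn]
      rw [if_neg hqn] at hA
      linear_combination hA

/-- **`U_M` on the level-raised Eisenstein coefficients**: for a prime `M` the coefficients
`b_n = a_n - [M ∣ n] a_{n/M}` of `F₂ = E - E(M·)` (`a_n = σ_j^χ(n)`) satisfy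
`b_{Mn} = χ(M) M^j b_n` (`n ≥ 1`) — i.e. `U_M F₂ = χ(M) M^j F₂`, since `a_n(U_M f) = a_{Mn}(f)` at
level divisible by `M` (Diamond–Shurman (5.3)); with `n = M^a m`, `M ∤ m`, both sides are
`σ_j^χ(m) (χ(M)M^j)^{a+1}` by multiplicativity and `σ_j^χ(M^a) = ∑_{i ≤ a} (χ(M)M^j)^i`.  This is the
`U_M`-eigenvalue of Billerey–Menares' `F₂` ("an eigenform for the full Hecke algebra at level
`NM`", §3.2), equal to `χ₂(M)M^{k-1}` for `χ₁ = 𝟙`.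
[cite: BillereyMenares2018, §3.2; DiamondShurman2005, Prop. 5.2.3 with (5.3)] -/
theorem levelRaised_heckeU {M : ℕ} (hM : M.Prime) {n : ℕ} (hn : n ≠ 0) :
    (∑ d ∈ (M * n).divisors, χ d * (d : R) ^ j) -
        (if M ∣ M * n then ∑ d ∈ (M * n / M).divisors, χ d * (d : R) ^ j else 0) =
      χ M * (M : R) ^ j *
        ((∑ d ∈ n.divisors, χ d * (d : R) ^ j) -
          (if M ∣ n then ∑ d ∈ (n / M).divisors, χ d * (d : R) ^ j else 0)) := by
  -- `n = M^a m` with `M ∤ m`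
  obtain ⟨a, m, hm, rfl⟩ := Nat.exists_eq_pow_mul_and_not_dvd hn M hM.ne_one
  have hcop : ∀ b, (M ^ b).Coprime m := fun b ↦
    (Nat.Coprime.pow_left b ((Nat.Prime.coprime_iff_not_dvd hM).2 hm))
  have h1 : M * (M ^ a * m) = M ^ (a + 1) * m := by ring
  have e1 : M ^ (a + 1) * m / M = M ^ a * m := by
    rw [pow_succ, mul_comm (M ^ a) M, mul_assoc, Nat.mul_div_cancel_left _ hM.pos]
  have hdvd : M ∣ M ^ a * m ↔ 1 ≤ a := by
    constructor
    · intro h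
      by_contra ha
      have : a = 0 := by omega
      subst this
      rw [pow_zero, one_mul] at h
      exact hm h
    · intro ha
      exact (dvd_pow_self M (by omega)).mul_right m
  have hdiv : 1 ≤ a → M ^ a * m / M = M ^ (a - 1) * m := fun ha ↦ by
    obtain ⟨b, rfl⟩ : ∃ b, a = b + 1 := ⟨a - 1, by omega⟩
    rw [Nat.add_sub_cancel, pow_succ, mul_assoc, mul_comm M m, ← mul_assoc, Nat.mul_div_cancel _ hM.pos]
  rw [h1, if_pos ((dvd_pow_self M a.succ_ne_zero).mul_right m), e1,
    twistedSigma_mul_of_coprime χ j (hcop (a + 1)), twistedSigma_mul_of_coprime χ j (hcop a),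
    twistedSigma_prime_pow χ j hM, twistedSigma_prime_pow χ j hM]
  have hif : (if M ∣ M ^ a * m then ∑ d ∈ (M ^ a * m / M).divisors, χ d * (d : R) ^ j else 0) =
      (if 1 ≤ a then ∑ i ∈ range a, (χ M * (M : R) ^ j) ^ i else 0) *
        ∑ d ∈ m.divisors, χ d * (d : R) ^ j := by
    by_cases ha : 1 ≤ a
    · rw [if_pos (hdvd.2 ha), if_pos ha, hdiv ha, twistedSigma_mul_of_coprime χ j (hcop (a - 1)),
        twistedSigma_prime_pow χ j hM, Nat.sub_add_cancel ha]
    · rw [if_neg (fun h ↦ ha (hdvd.1 h)), if_neg ha, zero_mul]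
  rw [hif, Finset.sum_range_succ _ (a + 1)]
  cases a with
  | zero =>
    rw [if_neg (by omega)]
    simp only [Finset.sum_range_succ, Finset.sum_range_zero]
    ring
  | succ b =>
    rw [if_pos (by omega), Finset.sum_range_succ _ (b + 1)]
    ring

/-- **`U_M` on the weighted level-raised coefficients**: for a prime `M` and the constant
`C = χ(M) M^j`, the coefficients `b_n = a_n - C [M ∣ n] a_{n/M}` (`a_n = σ_j^χ(n)`) of
`E - χ(M)M^j E(M·)` satisfy `b_{Mn} = b_n` (`n ≥ 1`) — `U_M`-eigenvalue `1`; e.g. Mazur's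
`E₂(z) - M E₂(Mz)` on `Γ₀(M)` (`χ = 𝟙`, `j = 1`, `C = M`): `U_M = 1` on it.  With `n = M^a m`,
`M ∤ m`, both sides equal `σ_j^χ(m)` (`∑_{i ≤ a+1} x^i - x ∑_{i ≤ a} x^i = 1`).
[cite: BillereyMenares2018, §3.2 (the case `(N,k) = (1,2)`, [Maz77, Prop. 5.12(iii)]); DiamondShurman2005, Prop. 5.2.3 with (5.3)] -/
theorem levelRaised_const_heckeU {M : ℕ} (hM : M.Prime) {n : ℕ} (hn : n ≠ 0) :
    (∑ d ∈ (M * n).divisors, χ d * (d : R) ^ j) -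
        χ M * (M : R) ^ j *
          (if M ∣ M * n then ∑ d ∈ (M * n / M).divisors, χ d * (d : R) ^ j else 0) =
      (∑ d ∈ n.divisors, χ d * (d : R) ^ j) -
        χ M * (M : R) ^ j * (if M ∣ n then ∑ d ∈ (n / M).divisors, χ d * (d : R) ^ j else 0) := by
  -- `n = M^a m` with `M ∤ m`
  obtain ⟨a, m, hm, rfl⟩ := Nat.exists_eq_pow_mul_and_not_dvd hn M hM.ne_one
  have hcop : ∀ b, (M ^ b).Coprime m := fun b ↦
    (Nat.Coprime.pow_left b ((Nat.Prime.coprime_iff_not_dvd hM).2 hm))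
  have h1 : M * (M ^ a * m) = M ^ (a + 1) * m := by ring
  have e1 : M ^ (a + 1) * m / M = M ^ a * m := by
    rw [pow_succ, mul_comm (M ^ a) M, mul_assoc, Nat.mul_div_cancel_left _ hM.pos]
  have hdvd : M ∣ M ^ a * m ↔ 1 ≤ a := by
    constructor
    · intro h
      by_contra ha
      have : a = 0 := by omega
      subst this
      rw [pow_zero, one_mul] at h
      exact hm h
    · intro ha
      exact (dvd_pow_self M (by omega)).mul_right m
  have hdiv : 1 ≤ a → M ^ a * m / M = M ^ (a - 1) * m := fun ha ↦ by
    obtain ⟨b, rfl⟩ : ∃ b, a = b + 1 := ⟨a - 1, by omega⟩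
    rw [Nat.add_sub_cancel, pow_succ, mul_assoc, mul_comm M m, ← mul_assoc, Nat.mul_div_cancel _ hM.pos]
  rw [h1, if_pos ((dvd_pow_self M a.succ_ne_zero).mul_right m), e1,
    twistedSigma_mul_of_coprime χ j (hcop (a + 1)), twistedSigma_mul_of_coprime χ j (hcop a),
    twistedSigma_prime_pow χ j hM, twistedSigma_prime_pow χ j hM]
  have hif : (if M ∣ M ^ a * m then ∑ d ∈ (M ^ a * m / M).divisors, χ d * (d : R) ^ j else 0) =
      (if 1 ≤ a then ∑ i ∈ range a, (χ M * (M : R) ^ j) ^ i else 0) *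
        ∑ d ∈ m.divisors, χ d * (d : R) ^ j := by
    by_cases ha : 1 ≤ a
    · rw [if_pos (hdvd.2 ha), if_pos ha, hdiv ha, twistedSigma_mul_of_coprime χ j (hcop (a - 1)),
        twistedSigma_prime_pow χ j hM, Nat.sub_add_cancel ha]
    · rw [if_neg (fun h ↦ ha (hdvd.1 h)), if_neg ha, zero_mul]
  rw [hif, show a + 1 + 1 = (a + 1) + 1 from rfl, geom_sum_succ]
  cases a with
  | zero =>
    rw [if_neg (by omega)]
    simp only [Finset.sum_range_succ, Finset.sum_range_zero]
    ring
  | succ b =>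
    rw [if_pos (by omega), geom_sum_succ]
    ring

end Literature.NumberTheory.ModularForms
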